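import Literature.NumberTheory.GaloisCohomology.Howard2004.TransportUnramified
import Literature.NumberTheory.GaloisRepresentations.ContinuousCupProductCompat
import HarnessLib

/-!
# Howard 2004, §1.3: isotropy under the H.4 pairing DESCENDS along a quotient `T ↠ T/IT`
# (functoriality of the cup product; theorems only)

Topic `NumberTheory/GaloisCohomology/Howard2004`. THEOREMS ONLY: no definition, no named fact, no
instance, no notation, no `sorry`. Cell `pub/bsd-print-x9`, print leaf G87
`Literature.NumberTheory.GaloisCohomology.Howard2004.thm161_dvrKolyvaginBound` (Howard Thm. 1.6.1);
seat `bsd-line-x10b-p1-w5` g7 (sequel to `ResidualDualityDatumProofs` and `RelaxedSelmerIsotropyProofs`: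
the hypothesis «`𝓕̄` isotropic under the residual pairing at `v ≠ q`» of the latter, for the datum of
the former, from H.4 for `T`).

SOURCE. B. Howard, Compositio Math. **140** (2004) = arXiv:1202.6340, §1.3: H.4 (p. 7 L69–82, the
local condition `𝓕` is its own exact orthogonal complement under `H¹(K_v, T) × H¹(K_v̄, T) → R`),
Remark 1.3.1 «base change» («the Selmer triple `(T/IT, 𝓕, 𝓛)` satisfies hypotheses H.0–H.5», used at
p. 11 L33–38 for `T^{(k)}` and throughout §1.5 for `T̄ = T/𝔪T` with the residual pairing of H.5(c)),
and Lemma 1.5.3 (b) (p. 10 L27–33: «the isotropy of the local conditions `𝓕(n)` (by H.4)»).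

WHAT IS PROVED, for a presentation `hq : IsQuotientBy ρ I ρbar πbar` (`π̄ : T ↠ T/IT`, any ideal `I`
of the level ring `A`), H.4 data `D` on `T` and `D̄` on `T/IT` COMPATIBLE in the sense
`D̄.e (π̄ s) (π̄ t) = c · D.e s t` for a fixed `c ∈ A` (the residual datum of
`ResidualDualityDatumProofs` has `c = ϖ^{e−1}`; a plain base change has `c = 1`):
* §1 `IsQuotientBy.transportH1_localCohomologyMap` — Howard's local transport commutes with `H¹(π̄)`:
  `transport_v (π̄_* y) = π̄_* (transport_v y)` (on `H¹(K_v, Tw ·)`).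
* §2 **`IsQuotientBy.localCup_localCohomologyMap_eq_zero`**: `x ∪_e transport_v y = 0` in
  `H²(K_v, A(1))` ⟹ `π̄_* x ∪_ē transport_v (π̄_* y) = 0` (cup-product functoriality
  `ContPairing.cupProduct_map` for the triple `(π̄, π̄, c·)`); hence
  **`IsQuotientBy.isotropic_propagateStructure`**: if `𝓕_v` annihilates the transport of `𝓕_{σ v}`
  under `D` (H.4 for `T` at `v`, one inclusion of `DualityDatum.IsSelfOrthogonalAt`, extracted by
  `DualityDatum.IsSelfOrthogonalAt.localCup_eq_zero`) then the PROPAGATED conditions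
  `𝓕̄ = hq.propagateStructure 𝓕` satisfy the same under `D̄` — the hypothesis of
  `DualityDatum.inv_cohomologyMap_localCup_transportH1_eq_zero` at the residual level.

NOT HERE: the opposite inclusion (exact orthogonal complement for `T/IT`, which needs H.3/cartesian
and counting); `thm161_dvrKolyvaginBound` is NOT proved; no summit statement is proved; the
Birch–Swinnerton-Dyer conjecture is not proved by any of this.
References: [Howard2004HeegnerKolyvagin] §1.3 H.4, Remark 1.3.1, Lemma 1.5.3; [NeukirchSchmidtWingberg2008]
I §4 (1.4.2) (functoriality of cup products).
-/

set_option autoImplicit false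

noncomputable section

open Function NumberField IsDedekindDomain Field CategoryTheory
open scoped NumberField

namespace Literature.NumberTheory.GaloisCohomology.Howard2004

open Literature.NumberTheory.GaloisRepresentations
open Literature.NumberTheory.GaloisRepresentations.DiscreteGaloisModule

variable {K : Type} [Field K] [NumberField K] {M : Type} [AddCommGroup M] [TopologicalSpace M]
  [DiscreteTopology M] {Nbar : Type} [AddCommGroup Nbar] [TopologicalSpace Nbar]
  [DiscreteTopology Nbar] {A : Type} [CommRing A] [Module A M] [Module A Nbar]
  {cd : ConjugationDatum K} {ρ : DiscreteGaloisModule K M} {ρbar : DiscreteGaloisModule K Nbar}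
  {I : Ideal A} {πbar : M →ₗ[A] Nbar}

/-! ## §1 Transport commutes with `H¹(π̄)` -/

namespace IsQuotientBy

/-- **`transport_v ∘ H¹(π̄) = H¹(π̄) ∘ transport_v`** on `H¹(K_{σ v}, T) → H¹(K_v, Tw(T/IT))`: both send
`[y]` to `[g ↦ π̄(δ_v · y(φ_v g))]` (`π̄` is equivariant). The right-hand `H¹(π̄)` is the map on the
cohomology of the TWISTED local modules induced by `π̄`.
[cite: Howard2004HeegnerKolyvagin, §1.3 (arXiv p. 7 L44–48) and Def. 1.1.3 (p. 5 L93–99)] -/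
theorem transportH1_localCohomologyMap (hq : IsQuotientBy ρ I ρbar πbar) (v : HeightOneSpectrum (𝓞 K))
    (y : galoisCohomology (ρ.toLocal (Sum.inr (cd.σ • v))) 1) :
    cd.transportH1 ρbar v (hq.localCohomologyMap (Sum.inr (cd.σ • v)) 1 y) =
      ContinuousRep.cohomologyMap ((cd.twist ρ).toLocal (Sum.inr v)) ((cd.twist ρbar).toLocal (Sum.inr v))
        πbar.toAddMonoidHom continuous_of_discreteTopology
        (fun g m => hq.equivariant (cd.conj (absGaloisRestrict K _ g)) m) 1
        (cd.transportH1 ρ v y) := by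
  obtain ⟨f, rfl⟩ := oneCocycleClass_surjective _ y
  -- `H¹(π̄)` on classes, for the local module at `σ v` and for the twisted local module at `v`
  have h1 : hq.localCohomologyMap (Sum.inr (cd.σ • v)) 1 (oneCocycleClass _ f) = oneCocycleClass _
      (contOneCocycles.pullback (ContinuousMonoidHom.id _)
        (X := (ρ.toLocal (Sum.inr (cd.σ • v))).toTopRep) (Y := (ρbar.toLocal (Sum.inr (cd.σ • v))).toTopRep)
        (TopRep.ofHom ⟨⟨πbar.toAddMonoidHom.toIntLinearMap, continuous_of_discreteTopology⟩,
          fun g => ContinuousLinearMap.ext fun m => hq.equivariant _ m⟩) f) :=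
    map_oneCocycleClass _ _ _ f
  rw [h1, ConjugationDatum.transportH1_oneCocycleClass, ConjugationDatum.transportH1_oneCocycleClass]
  refine Eq.trans ?_ (map_oneCocycleClass _ _ _ _).symm
  congr 1
  refine Subtype.ext (ContinuousMap.ext fun g => ?_)
  change ρbar (cd.δ v) (πbar (f.1 (cd.φ v g))) = πbar (ρ (cd.δ v) (f.1 (cd.φ v g)))
  rw [hq.equivariant]

end IsQuotientBy

/-! ## §2 Isotropy descends -/

namespace DualityDatum

variable [TopologicalSpace A] [DiscreteTopology A] {p : ℕ} [Fact p.Prime] [Algebra ℤ_[p] A]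

/-- One inclusion of H.4 (`IsSelfOrthogonalAt`): the classes of `𝓕_v` annihilate the transport of
`𝓕_{σ v}`. [cite: Howard2004HeegnerKolyvagin, §1.3 H.4 (arXiv p. 7 L78–82)] -/
theorem IsSelfOrthogonalAt.localCup_eq_zero {D : DualityDatum p cd ρ A} {𝓕 : SelmerStructure ρ}
    {v : HeightOneSpectrum (𝓞 K)} (h : D.IsSelfOrthogonalAt 𝓕 v)
    {x : galoisCohomology (ρ.toLocal (Sum.inr v)) 1} (hx : x ∈ 𝓕 (Sum.inr v))
    {y : galoisCohomology ((cd.twist ρ).toLocal (Sum.inr v)) 1}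
    (hy : y ∈ (𝓕 (Sum.inr (cd.σ • v))).map (cd.transportH1 ρ v)) : D.localCup (Sum.inr v) x y = 0 :=
  (h.1 x).mp hx y hy

/-- **Isotropy descends along `π̄ : T ↠ T/IT`** (cup-product functoriality for the compatible triple
`(π̄, π̄, c·)`): if `x ∪_e transport_v y = 0` in `H²(K_v, A(1))` for `x ∈ H¹(K_v, T)`,
`y ∈ H¹(K_{σ v}, T)`, then `π̄_* x ∪_ē transport_v (π̄_* y) = 0` for any datum `D̄` on `T/IT` with
`ē(π̄ s, π̄ t) = c · e(s, t)`. [cite: Howard2004HeegnerKolyvagin, §1.3 H.4 and Remark 1.3.1 (arXiv p. 7 L69–82, L109–115)] [cite: NeukirchSchmidtWingberg2008, I §4 (1.4.2)] -/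
theorem localCup_localCohomologyMap_eq_zero (hq : IsQuotientBy ρ I ρbar πbar)
    (D : DualityDatum p cd ρ A) (Dbar : DualityDatum p cd ρbar A) (c : A)
    (hD : ∀ s t : M, Dbar.e (πbar s) (πbar t) = c * D.e s t) (v : HeightOneSpectrum (𝓞 K))
    {x : galoisCohomology (ρ.toLocal (Sum.inr v)) 1}
    {y : galoisCohomology (ρ.toLocal (Sum.inr (cd.σ • v))) 1}
    (h : D.localCup (Sum.inr v) x (cd.transportH1 ρ v y) = 0) :
    Dbar.localCup (Sum.inr v) (hq.localCohomologyMap (Sum.inr v) 1 x)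
      (cd.transportH1 ρbar v (hq.localCohomologyMap (Sum.inr (cd.σ • v)) 1 y)) = 0 := by
  haveI : CompactSpace (absoluteGaloisGroup (Place.Completion (Sum.inr v : Place K))) :=
    absoluteGaloisGroup_compactSpace _
  -- the three morphisms of local topological representations
  let α : (ρ.toLocal (Sum.inr v)).toTopRep ⟶ (ρbar.toLocal (Sum.inr v)).toTopRep :=
    TopRep.ofHom ⟨⟨πbar.toAddMonoidHom.toIntLinearMap, continuous_of_discreteTopology⟩,
      fun g => ContinuousLinearMap.ext fun m => hq.equivariant _ m⟩
  let β : ((cd.twist ρ).toLocal (Sum.inr v)).toTopRep ⟶ ((cd.twist ρbar).toLocal (Sum.inr v)).toTopRep :=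
    TopRep.ofHom ⟨⟨πbar.toAddMonoidHom.toIntLinearMap, continuous_of_discreteTopology⟩,
      fun g => ContinuousLinearMap.ext fun m => hq.equivariant _ m⟩
  let γ : (D.twistOne.toLocal (Sum.inr v)).toTopRep ⟶ (Dbar.twistOne.toLocal (Sum.inr v)).toTopRep :=
    TopRep.ofHom ⟨⟨(AddMonoidHom.mulLeft c).toIntLinearMap, continuous_of_discreteTopology⟩,
      fun g => ContinuousLinearMap.ext fun r => by
        change c * D.twistOne (absGaloisRestrict K _ g) r = Dbar.twistOne (absGaloisRestrict K _ g) (c * r)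
        rw [D.twistOne_apply, Dbar.twistOne_apply]
        ring⟩
  -- `H¹(π̄)` on `H¹(K_v, T)` is `cohomologyMap α` (both are `[χ] ↦ [π̄ ∘ χ]`)
  have hα : ∀ z, hq.localCohomologyMap (Sum.inr v) 1 z = cohomologyMap α 1 z := by
    intro z
    obtain ⟨χ, rfl⟩ := oneCocycleClass_surjective _ z
    have e1 : hq.localCohomologyMap (Sum.inr v) 1 (oneCocycleClass _ χ) = oneCocycleClass _
        (contOneCocycles.pullback (ContinuousMonoidHom.id _)
          (X := (ρ.toLocal (Sum.inr v)).toTopRep) (Y := (ρbar.toLocal (Sum.inr v)).toTopRep)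
          (TopRep.ofHom ⟨⟨πbar.toAddMonoidHom.toIntLinearMap, continuous_of_discreteTopology⟩,
            fun g => ContinuousLinearMap.ext fun m => hq.equivariant _ m⟩) χ) :=
      map_oneCocycleClass _ _ _ χ
    rw [e1, cohomologyMap_oneCocycleClass]
    rfl
  -- transport commutes with `H¹(π̄)`: the twisted side is `cohomologyMap β`
  have hβ : cd.transportH1 ρbar v (hq.localCohomologyMap (Sum.inr (cd.σ • v)) 1 y) =
      cohomologyMap β 1 (cd.transportH1 ρ v y) := hq.transportH1_localCohomologyMap v y
  -- cup-product functoriality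
  have hcup := ContPairing.cupProduct_map (D.ePairingLocal (Sum.inr v)) (Dbar.ePairingLocal (Sum.inr v))
    α β γ (fun s t => (hD s t).symm) x (cd.transportH1 ρ v y)
  rw [hα, hβ]
  change (Dbar.ePairingLocal (Sum.inr v)).cupProduct (cohomologyMap α 1 x)
    (cohomologyMap β 1 (cd.transportH1 ρ v y)) = 0
  rw [← hcup]
  change cohomologyMap γ 2 (D.localCup (Sum.inr v) x (cd.transportH1 ρ v y)) = 0
  rw [h]
  exact map_zero _

/-- **H.4-isotropy for `T` gives isotropy for the propagated conditions on `T/IT`**: if at the finite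
place `v` every class of `𝓕_v` annihilates the transport of `𝓕_{σ v}` under `∪_e` (H.4 for `T`), then
every class of `𝓕̄_v = π̄_*(𝓕_v)` annihilates the transport of `𝓕̄_{σ v}` under `∪_ē` — the hypothesis
`horth` of `RelaxedSelmerIsotropyProofs` at the residual level (Howard, Remark 1.3.1: «the Selmer
triple `(T/IT, 𝓕, 𝓛)` satisfies hypotheses H.0–H.5»; here the isotropy half of H.4).
[cite: Howard2004HeegnerKolyvagin, §1.3 H.4 and Remark 1.3.1 (arXiv p. 7 L69–82, L109–115)] -/
theorem isotropic_propagateStructure (hq : IsQuotientBy ρ I ρbar πbar)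
    (D : DualityDatum p cd ρ A) (Dbar : DualityDatum p cd ρbar A) (c : A)
    (hD : ∀ s t : M, Dbar.e (πbar s) (πbar t) = c * D.e s t) (𝓕 : SelmerStructure ρ)
    (v : HeightOneSpectrum (𝓞 K))
    (h : ∀ x ∈ 𝓕 (Sum.inr v), ∀ y ∈ (𝓕 (Sum.inr (cd.σ • v))).map (cd.transportH1 ρ v),
      D.localCup (Sum.inr v) x y = 0) :
    ∀ x ∈ hq.propagateStructure 𝓕 (Sum.inr v),
      ∀ y ∈ (hq.propagateStructure 𝓕 (Sum.inr (cd.σ • v))).map (cd.transportH1 ρbar v),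
        Dbar.localCup (Sum.inr v) x y = 0 := by
  intro x' hx' y' hy'
  rw [IsQuotientBy.propagateStructure_apply, AddSubgroup.mem_map] at hx'
  rw [IsQuotientBy.propagateStructure_apply, AddSubgroup.mem_map] at hy'
  obtain ⟨x, hx, rfl⟩ := hx'
  obtain ⟨z, hz, rfl⟩ := hy'
  obtain ⟨y, hy, rfl⟩ := AddSubgroup.mem_map.mp hz
  exact localCup_localCohomologyMap_eq_zero hq D Dbar c hD v
    (h x hx _ (AddSubgroup.mem_map_of_mem _ hy))

/-- The same from the full H.4 clause `IsSelfOrthogonalAt` for `T`.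
[cite: Howard2004HeegnerKolyvagin, §1.3 H.4 and Remark 1.3.1 (arXiv p. 7 L69–82, L109–115)] -/
theorem isotropic_propagateStructure_of_isSelfOrthogonalAt (hq : IsQuotientBy ρ I ρbar πbar)
    (D : DualityDatum p cd ρ A) (Dbar : DualityDatum p cd ρbar A) (c : A)
    (hD : ∀ s t : M, Dbar.e (πbar s) (πbar t) = c * D.e s t) (𝓕 : SelmerStructure ρ)
    (v : HeightOneSpectrum (𝓞 K)) (h : D.IsSelfOrthogonalAt 𝓕 v) :
    ∀ x ∈ hq.propagateStructure 𝓕 (Sum.inr v),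
      ∀ y ∈ (hq.propagateStructure 𝓕 (Sum.inr (cd.σ • v))).map (cd.transportH1 ρbar v),
        Dbar.localCup (Sum.inr v) x y = 0 :=
  isotropic_propagateStructure hq D Dbar c hD 𝓕 v fun _ hx _ hy => h.localCup_eq_zero hx hy

end DualityDatum

end Literature.NumberTheory.GaloisCohomology.Howard2004
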